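import Literature.AlgebraicGeometry.Motives.AbelianVarietyEquivariantQuasiDecompositionPerfectField
import Literature.Algebra.Polynomial.IntegerSeparabilityCertificate
import Literature.NumberTheory.NumberFields.RingOfIntegersGeneratorMultiple
import Mathlib.FieldTheory.PrimitiveElement
import Mathlib.FieldTheory.Minpoly.IsIntegrallyClosed
import Mathlib.RingTheory.Localization.Integral
import Mathlib.NumberTheory.NumberField.Basic
import HarnessLib

/-!
# Poincaré's complete reducibility theorem with complex multiplication by `𝓞_K`, over a perfect field

The turnkey forms of `AbelianVariety.exists_equivariant_complement_of_generator`
(`Motives/AbelianVarietyPoincareEquivariantPerfectField`) and of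
`AbelianVariety.exists_equivariant_quasiDecomposition_of_generator`
(`Motives/AbelianVarietyEquivariantQuasiDecompositionPerfectField`) for the maximal order of a
number field: all their side hypotheses — a generator `α` of the order up to isogeny, an integral polynomial `f`
with `f(α) = 0` and an integral Bézout certificate `c_u f + c_v f' = D ≠ 0` — are DISCHARGED for
`R = 𝓞_K`, `K` any number field (in the tree's CM vocabulary `ι : 𝓞 K →+* End A`):

* `NumberField.RingOfIntegers.exists_generator_certificate` — there are `α ∈ 𝓞_K` with
  `ℚ[α] = K`, its minimal polynomial `f ∈ ℤ[T]` (so `f(α) = 0`), `c_u, c_v ∈ ℤ[T]` and `D ≠ 0`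
  with `c_u f + c_v f' = D`, and every `r ∈ 𝓞_K` has `m r = p(α)` for some `m ≠ 0`, `p ∈ ℤ[T]`
  (primitive element theorem, an integral multiple of a primitive element, separability in
  characteristic zero, `Polynomial.exists_int_certificate_of_separable_map`,
  `NumberField.RingOfIntegers.exists_natCast_mul_eq_aeval`);
* `AbelianVariety.exists_equivariant_complement_of_ringOfIntegers` — **over a perfect field, an
  `𝓞_K`-stable abelian subvariety `i : Y ↪ X` of an abelian variety with `𝓞_K`-action has an
  `𝓞_K`-stable complement**: `Z` with `χ : 𝓞 K →+* End Z`, an equivariant closed immersion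
  `j : Z ↪ X`, an equivariant quasi-retraction `h` of `i` and an equivariant `t : X ⟶ Z` with
  `(i, j) : Y ⊞ Z ⟶ X`, `(h, t) : X ⟶ Y ⊞ Z` mutually quasi-inverse isogenies and
  `dim Y + dim Z = dim X` (Mumford §19 Thm. 1 with complex multiplication; Milne Prop. 12.1);
* `AbelianVariety.exists_equivariant_quasiDecomposition_of_ringOfIntegers` — **over a perfect
  field, every abelian variety with `𝓞_K`-action decomposes up to isogeny, `𝓞_K`-equivariantly,
  into finitely many `𝓞_K`-SIMPLE abelian varieties** (equivariant `ιᵢ : Sᵢ ⟶ X`, `πᵢ : X ⟶ Sᵢ`,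
  `N ≥ 1`, `ιᵢ ≫ πᵢ = N`, `ιᵢ ≫ πⱼ = 0`, `∑ πᵢ ≫ ιᵢ = N`; instance of
  `Motives/AbelianVarietyEquivariantQuasiDecompositionPerfectField`; Mumford §19 Cor. 1 with complex
  multiplication).

Everything is proved; no definition, no named fact (D-0026).

## References

* D. Mumford, *Abelian Varieties* (1970), §19 Thm. 1 and Cor. 1–2 (pp. 173–174). [MumfordAV1970]
* J. S. Milne, *Abelian Varieties*, in Cornell–Silverman (eds.), *Arithmetic Geometry* (1986),
  Prop. 12.1 (p. 122). [Milne1986AbelianVarieties]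
* J. Neukirch, *Algebraic Number Theory*, Grundlehren 322 (1999), Ch. I §2 (`ℤ[α] ⊆ 𝓞_K` of
  finite index for a primitive algebraic integer `α`). [NeukirchANT1999]
-/

noncomputable section

universe u

open CategoryTheory CategoryTheory.Limits AlgebraicGeometry Polynomial
open scoped Polynomial NumberField

namespace NumberField.RingOfIntegers

/-- **A primitive algebraic integer with its separability certificate.** For a number field `K`
there are `α ∈ 𝓞_K` generating `K` over `ℚ` (`ℚ[α] = K`), an integral polynomial `f` (the minimal
polynomial of `α`) with `f(α) = 0`, integral polynomials `c_u, c_v` and an integer `D ≠ 0` with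
`c_u f + c_v f' = D`, and every `r ∈ 𝓞_K` satisfies `m r = p(α)` for some `m ∈ ℕ`, `m ≠ 0`,
`p ∈ ℤ[T]` — the hypotheses of
`AbelianVariety.exists_equivariant_complement_of_generator` for `R = 𝓞_K`.
[cite: NeukirchANT1999, Ch. I §2 (Prop. 2.10 and (2.9))] -/
theorem exists_generator_certificate (K : Type*) [Field K] [NumberField K] :
    ∃ (α : 𝓞 K) (f cu cv : ℤ[X]) (D : ℤ), D ≠ 0 ∧ aeval α f = 0 ∧
      cu * f + cv * derivative f = C D ∧
      ∀ r : 𝓞 K, ∃ (m : ℕ) (p : ℤ[X]), m ≠ 0 ∧ (m : 𝓞 K) * r = aeval α p := by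
  -- a primitive element, made integral
  obtain ⟨α₀, hα₀⟩ := Field.exists_primitive_element ℚ K
  obtain ⟨y, hy, hint⟩ := ((IsFractionRing.isAlgebraic_iff ℤ ℚ K).2
    (Algebra.IsAlgebraic.isAlgebraic (R := ℚ) α₀)).exists_integral_multiple
  set α : 𝓞 K := ⟨y • α₀, hint⟩ with hαdef
  have hαK : ((α : 𝓞 K) : K) = y • α₀ := rfl
  -- `ℚ⟮α⟯ = ⊤`
  have hadj : IntermediateField.adjoin ℚ {((α : 𝓞 K) : K)} = ⊤ := by
    apply le_antisymm le_top
    rw [← hα₀]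
    apply IntermediateField.adjoin_simple_le_iff.2
    have hyQ : (y : ℚ) ≠ 0 := by exact_mod_cast hy
    have e : α₀ = (y : ℚ)⁻¹ • (y • α₀) := by
      rw [← Int.cast_smul_eq_zsmul ℚ, smul_smul, inv_mul_cancel₀ hyQ, one_smul]
    rw [e, ← hαK]
    exact IntermediateField.smul_mem _ (IntermediateField.mem_adjoin_simple_self ℚ _)
  -- `ℚ[α] = ⊤` as a subalgebra
  have halgQ : IsAlgebraic ℚ ((α : 𝓞 K) : K) := Algebra.IsAlgebraic.isAlgebraic _
  have hadjA : Algebra.adjoin ℚ {((α : 𝓞 K) : K)} = ⊤ := by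
    rw [← IntermediateField.adjoin_simple_toSubalgebra_of_isAlgebraic halgQ, hadj]
    rfl
  -- the minimal polynomial over `ℤ` and its separability over `ℚ`
  have hintZ : IsIntegral ℤ ((α : 𝓞 K) : K) := α.isIntegral_coe
  have hmin : minpoly ℚ ((α : 𝓞 K) : K) = (minpoly ℤ ((α : 𝓞 K) : K)).map (Int.castRingHom ℚ) := by
    rw [minpoly.isIntegrallyClosed_eq_field_fractions' ℚ hintZ]
    rfl
  have hsep : ((minpoly ℤ ((α : 𝓞 K) : K)).map (Int.castRingHom ℚ)).Separable := by
    rw [← hmin]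
    exact Algebra.IsSeparable.isSeparable ℚ _
  obtain ⟨cu, cv, D, hD, hcert⟩ :=
    Polynomial.exists_int_certificate_of_separable_map _ hsep
  refine ⟨α, minpoly ℤ ((α : 𝓞 K) : K), cu, cv, D, hD, ?_, hcert,
    exists_natCast_mul_eq_aeval α hadjA⟩
  -- `f(α) = 0` in `𝓞 K`
  apply RingOfIntegers.coe_injective
  rw [map_zero, ← aeval_algebraMap_apply]
  exact minpoly.aeval ℤ _

end NumberField.RingOfIntegers

namespace Literature.AlgebraicGeometry.Motives

namespace AbelianVariety

variable {k : Type u} [Field k] [PerfectField k] {X Y : AbelianVariety k}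

/-- **Poincaré's complete reducibility theorem with complex multiplication by the maximal order
`𝓞_K` of a number field, over a perfect field.** Let `𝓞_K` act on abelian varieties `X`, `Y`
over a perfect field (`φ : 𝓞 K →+* End X`, `ψ : 𝓞 K →+* End Y`) and let `i : Y ↪ X` be an
`𝓞_K`-equivariant abelian subvariety. Then there are an abelian variety `Z` with `𝓞_K`-action
`χ : 𝓞 K →+* End Z`, an equivariant closed immersion `j : Z ↪ X`, an equivariant
quasi-retraction `h` of `i` (`i ≫ h = M • 𝟙 Y`, `M ≠ 0`) and an equivariant `t : X ⟶ Z` such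
that `(i, j) : Y ⊞ Z ⟶ X` and `(h, t) : X ⟶ Y ⊞ Z` are mutually quasi-inverse isogenies
(`(h, t) ≫ (i, j) = M • 𝟙`, `(i, j) ≫ (h, t) = M • 𝟙`) and `dim Y + dim Z = dim X` — the
`𝓞_K`-stable isogeny complement of an `𝓞_K`-stable abelian subvariety. All side hypotheses of
`exists_equivariant_complement_of_generator` are discharged by
`NumberField.RingOfIntegers.exists_generator_certificate`.
[cite: MumfordAV1970, §19 Thm. 1 (pp. 173–174)] [cite: Milne1986AbelianVarieties, Prop. 12.1 (p. 122)] -/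
theorem exists_equivariant_complement_of_ringOfIntegers {K : Type*} [Field K] [NumberField K]
    (φ : 𝓞 K →+* End X) (ψ : 𝓞 K →+* End Y) (i : Y ⟶ X) [IsClosedImmersion (Hom.toSchemeHom i)]
    (hi : ∀ r : 𝓞 K, i ≫ End.asHom (φ r) = End.asHom (ψ r) ≫ i) :
    ∃ (h : X ⟶ Y) (M : ℕ) (Z : AbelianVariety k) (χ : 𝓞 K →+* End Z) (j : Z ⟶ X) (t : X ⟶ Z),
      M ≠ 0 ∧ i ≫ h = M • 𝟙 Y ∧ (∀ r : 𝓞 K, End.asHom (φ r) ≫ h = h ≫ End.asHom (ψ r)) ∧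
      IsClosedImmersion (Hom.toSchemeHom j) ∧ IsIsogeny (biprod.desc i j) ∧
      IsIsogeny (biprod.lift h t) ∧ Y.dim + Z.dim = X.dim ∧
      biprod.lift h t ≫ biprod.desc i j = M • 𝟙 X ∧
      biprod.desc i j ≫ biprod.lift h t = M • 𝟙 (Y ⊞ Z) ∧
      (∀ r : 𝓞 K, End.asHom (χ r) ≫ j = j ≫ End.asHom (φ r)) ∧
      (∀ r : 𝓞 K, t ≫ End.asHom (χ r) = End.asHom (φ r) ≫ t) := by
  obtain ⟨α, f, cu, cv, D, hD, hf, hcert, hgen⟩ :=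
    NumberField.RingOfIntegers.exists_generator_certificate K
  exact exists_equivariant_complement_of_generator φ ψ i hi α f cu cv D hD hf hcert hgen

/-- **Decomposition up to isogeny into `𝓞_K`-simple pieces, over a perfect field.** Every abelian
variety `X` over a perfect field with an action `φ : 𝓞 K →+* End X` of the maximal order of a
number field `K` admits finitely many abelian varieties `Sᵢ` with `𝓞_K`-actions
`χᵢ : 𝓞 K →+* End Sᵢ`, each **`𝓞_K`-simple** (no abelian variety `W` with `𝓞_K`-action and
equivariant closed immersion `W ↪ Sᵢ` of dimension `0 < dim W < dim Sᵢ`), EQUIVARIANT morphisms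
`ιᵢ : Sᵢ ⟶ X`, `πᵢ : X ⟶ Sᵢ` and `N ≥ 1` with `ιᵢ ≫ πᵢ = N • 𝟙`, `ιᵢ ≫ πⱼ = 0` for `i ≠ j`
and `∑ᵢ πᵢ ≫ ιᵢ = N • 𝟙 X`: `X` is `𝓞_K`-equivariantly isogenous to `⊕ᵢ Sᵢ` — the isogeny
factors of an abelian variety with complex multiplication, with their induced `𝓞_K`-action.
[cite: MumfordAV1970, §19 Thm. 1 and Cor. 1 (pp. 173–174)]
[cite: Milne1986AbelianVarieties, Prop. 12.1 (p. 122)] -/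
theorem exists_equivariant_quasiDecomposition_of_ringOfIntegers {K : Type*} [Field K]
    [NumberField K] (X : AbelianVariety k) (φ : 𝓞 K →+* End X) :
    ∃ (I : Type) (_ : Fintype I) (S : I → AbelianVariety k) (χ : ∀ i, 𝓞 K →+* End (S i))
      (ι : ∀ i, S i ⟶ X) (π : ∀ i, X ⟶ S i) (N : ℕ),
      (∀ i, ∀ (W : AbelianVariety k) (ω : 𝓞 K →+* End W) (w : W ⟶ S i),
        IsClosedImmersion (Hom.toSchemeHom w) →
        (∀ r : 𝓞 K, w ≫ End.asHom (χ i r) = End.asHom (ω r) ≫ w) →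
        0 < W.dim → W.dim < (S i).dim → False) ∧
      0 < N ∧ (∀ i, ι i ≫ π i = N • 𝟙 (S i)) ∧ (∀ i j, i ≠ j → ι i ≫ π j = 0) ∧
      ∑ i, π i ≫ ι i = N • 𝟙 X ∧
      (∀ i (r : 𝓞 K), ι i ≫ End.asHom (φ r) = End.asHom (χ i r) ≫ ι i) ∧
      (∀ i (r : 𝓞 K), End.asHom (φ r) ≫ π i = π i ≫ End.asHom (χ i r)) := by
  obtain ⟨α, f, cu, cv, D, hD, hf, hcert, hgen⟩ :=
    NumberField.RingOfIntegers.exists_generator_certificate K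
  exact exists_equivariant_quasiDecomposition_of_generator α f cu cv D hD hf hcert hgen X φ

end AbelianVariety

end Literature.AlgebraicGeometry.Motives

end
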